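import Mathlib

/-!
# Route `FilamentSkeletonRss` · child crux `TangentSkeletonNearStraightL` (stmt-NavierStokesRegularity-23320) · registered line
# `child_tangent_analytic_strip_L` (b0b56c52900dd90a), stub `stub_stripPropagation` — brick: UNIT SPEED CONTINUES BILINEARLY

The registered stub `StripPropagation` shifts the contour of the matched Biot–Savart integral along a STADIUM-ANALYTIC curve
(`StadiumAnalyticCurve hs L cc X`: an analytic `F : ℂ → ℂ³` on the stadium with `F t = cplx (X t)` at real points, `‖F′‖ ≤ 2`); the
mechanism named in the skeleton («real unit speed continues to `⟨F′,F′⟩ = 1` bilinearly») is what keeps the complexified squared chord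
`Σᵢ (Fᵢ(z) − Fᵢ(z+s))²` close to `s²` and the kernel on its principal branch.  This file proves that mechanism as a stand-alone lemma of
complex analysis: if `F` is complex-differentiable on an open preconnected `U ⊆ ℂ` containing a real segment `[a, b]` (`a < b`) on which
`F t = (⟪X t, eᵢ⟫)ᵢ` for a curve `X : ℝ → ℝ³` differentiable with `‖X′‖ = 1` there, then `Σᵢ (F′(z))ᵢ² = 1` for EVERY `z ∈ U`
(`sum_sq_deriv_eq_one_of_unit_speed`).  Proof: at real points the complex derivative of `F` is the real derivative of `t ↦ F t`
(`HasDerivAt.comp_ofReal`), i.e. `(⟪X′ t, eᵢ⟫)ᵢ`, whose squares sum to `‖X′ t‖² = 1`; the analytic function `Σᵢ (F′)ᵢ² − 1` vanishes on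
the segment, hence on `U` (identity theorem).
HONEST FRAMING: an elementary brick for a plan about a HYPOTHETICAL filament skeleton on the NEGATIVE side of a MODEL route; the stub
`stub_stripPropagation` is NOT closed; nothing here bears on Navier–Stokes regularity or blow-up.  `--supports stmt-NavierStokesRegularity-23320`.
-/

set_option linter.dupNamespace false

noncomputable section

namespace Summit.NavierStokesRegularity.NavierStokesRegularity.Theorems.StadiumBilinearUnitSpeed

open Set Filter Topology
open scoped InnerProductSpace ComplexConjugate BigOperators

/-- **At a real point of the segment, the complex derivative of the stadium extension is the complexified real tangent**:
`F′(t) = (⟪X′ t, eᵢ⟫)ᵢ`. [folklore] -/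
theorem deriv_eq_tangent_of_eqOn_real {U : Set ℂ} (hU : IsOpen U) {F : ℂ → (Fin 3 → ℂ)} (hF : DifferentiableOn ℂ F U)
    {X : ℝ → EuclideanSpace ℝ (Fin 3)} {a b : ℝ}
    (hsub : ∀ t : ℝ, t ∈ Set.Icc a b → (t : ℂ) ∈ U)
    (hFX : ∀ t : ℝ, t ∈ Set.Icc a b → F t = fun i => ((⟪X t, EuclideanSpace.single i (1:ℝ)⟫_ℝ : ℝ) : ℂ))
    (hX : ∀ t ∈ Set.Icc a b, DifferentiableAt ℝ X t) :
    ∀ t ∈ Set.Ioo a b, deriv F (t : ℂ) = fun i => ((⟪deriv X t, EuclideanSpace.single i (1:ℝ)⟫_ℝ : ℝ) : ℂ) := by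
  intro t ht
  have htI : t ∈ Icc a b := Ioo_subset_Icc_self ht
  have hdF : HasDerivAt F (deriv F (t : ℂ)) (t : ℂ) :=
    (hF.differentiableAt (hU.mem_nhds (hsub t htI))).hasDerivAt
  have h0 : HasDerivAt (fun y : ℝ => ((y : ℝ) : ℂ)) ((1 : ℝ) : ℂ) t := (hasDerivAt_id t).ofReal_comp
  have h1' := hdF.scomp t h0
  have h1 : HasDerivAt (fun y : ℝ => F (y : ℂ)) (deriv F (t : ℂ)) t := by
    have e : (((1 : ℝ) : ℂ) • deriv F (t : ℂ)) = deriv F (t : ℂ) := by rw [Complex.ofReal_one, one_smul]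
    rw [e] at h1'
    exact h1'
  have h2 : HasDerivAt (fun y : ℝ => fun i => ((⟪X y, EuclideanSpace.single i (1:ℝ)⟫_ℝ : ℝ) : ℂ))
      (fun i => ((⟪deriv X t, EuclideanSpace.single i (1:ℝ)⟫_ℝ : ℝ) : ℂ)) t := by
    refine hasDerivAt_pi.2 fun i => ?_
    have hXd : HasDerivAt X (deriv X t) t := (hX t htI).hasDerivAt
    have h3 : HasDerivAt (fun y => ⟪X y, EuclideanSpace.single i (1:ℝ)⟫_ℝ)
        ⟪deriv X t, EuclideanSpace.single i (1:ℝ)⟫_ℝ t := by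
      have := hXd.inner ℝ (hasDerivAt_const t (EuclideanSpace.single i (1:ℝ)))
      simpa using this
    exact h3.ofReal_comp
  have hev : (fun y : ℝ => F (y : ℂ)) =ᶠ[𝓝 t]
      (fun y : ℝ => fun i => ((⟪X y, EuclideanSpace.single i (1:ℝ)⟫_ℝ : ℝ) : ℂ)) :=
    Filter.eventuallyEq_of_mem (Ioo_mem_nhds ht.1 ht.2) fun y hy => hFX y (Ioo_subset_Icc_self hy)
  exact h1.unique (h2.congr_of_eventuallyEq hev)

/-- **Unit speed continues bilinearly.**  `F : ℂ → ℂ³` complex-differentiable on an open preconnected `U` containing the real segment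
`[a, b]` (`a < b`), equal there to the complexified curve `t ↦ (⟪X t, eᵢ⟫)ᵢ` with `X` differentiable and `‖X′‖ = 1` on `[a, b]`:
then `Σᵢ (F′(z))ᵢ² = 1` for every `z ∈ U` (identity theorem from the segment). [folklore] -/
theorem sum_sq_deriv_eq_one_of_unit_speed {U : Set ℂ} (hU : IsOpen U) (hUc : IsPreconnected U)
    {F : ℂ → (Fin 3 → ℂ)} (hF : DifferentiableOn ℂ F U) {X : ℝ → EuclideanSpace ℝ (Fin 3)} {a b : ℝ} (hab : a < b)
    (hsub : ∀ t : ℝ, t ∈ Set.Icc a b → (t : ℂ) ∈ U)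
    (hFX : ∀ t : ℝ, t ∈ Set.Icc a b → F t = fun i => ((⟪X t, EuclideanSpace.single i (1:ℝ)⟫_ℝ : ℝ) : ℂ))
    (hX : ∀ t ∈ Set.Icc a b, DifferentiableAt ℝ X t) (hunit : ∀ t ∈ Set.Icc a b, ‖deriv X t‖ = 1) :
    ∀ z ∈ U, ∑ i, (deriv F z i) ^ 2 = 1 := by
  have hreal := deriv_eq_tangent_of_eqOn_real hU hF hsub hFX hX
  -- the defect vanishes at the real points of `(a, b)`
  have hzero : ∀ t ∈ Set.Ioo a b, (∑ i, (deriv F (t : ℂ) i) ^ 2) - 1 = 0 := by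
    intro t ht
    rw [hreal t ht]
    have hu := hunit t (Ioo_subset_Icc_self ht)
    have h2 : ∑ i, (deriv X t i) ^ 2 = 1 := by rw [← EuclideanSpace.real_norm_sq_eq, hu, one_pow]
    have h3 : (∑ i, (((⟪deriv X t, EuclideanSpace.single i (1:ℝ)⟫_ℝ : ℝ) : ℂ)) ^ 2) = ((∑ i, (deriv X t i) ^ 2 : ℝ) : ℂ) := by
      push_cast
      refine Finset.sum_congr rfl fun i _ => ?_
      rw [EuclideanSpace.inner_single_right]
      simp
    rw [h3, h2]
    simp
  -- the defect is analytic on `U`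
  have hdF : DifferentiableOn ℂ (deriv F) U := ((hF.analyticOnNhd hU).deriv).differentiableOn
  have hc : ∀ i, DifferentiableOn ℂ (fun z => deriv F z i) U := fun i => differentiableOn_pi.1 hdF i
  have hGd : DifferentiableOn ℂ (fun z => (∑ i, (deriv F z i) ^ 2) - 1) U :=
    (DifferentiableOn.fun_sum fun i _ => (hc i).pow 2).sub_const 1
  have hGa : AnalyticOnNhd ℂ (fun z => (∑ i, (deriv F z i) ^ 2) - 1) U := hGd.analyticOnNhd hU
  -- identity theorem from the segment
  set t₀ : ℝ := (a + b) / 2 with ht₀def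
  have ht₀ : t₀ ∈ Ioo a b := by constructor <;> (rw [ht₀def]; linarith)
  have htend : Tendsto (fun t : ℝ => (t : ℂ)) (𝓝[≠] t₀) (𝓝[≠] ((t₀ : ℝ) : ℂ)) := by
    refine tendsto_nhdsWithin_of_tendsto_nhds_of_eventually_within _
      (Complex.continuous_ofReal.continuousAt.mono_left nhdsWithin_le_nhds) ?_
    filter_upwards [self_mem_nhdsWithin] with t ht
    simpa using ht
  have hev : ∀ᶠ t : ℝ in 𝓝[≠] t₀, (∑ i, (deriv F (t : ℂ) i) ^ 2) - 1 = 0 := by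
    have : ∀ᶠ t : ℝ in 𝓝[≠] t₀, t ∈ Ioo a b := mem_nhdsWithin_of_mem_nhds (Ioo_mem_nhds ht₀.1 ht₀.2)
    exact this.mono fun t ht => hzero t ht
  have hfreq : ∃ᶠ z in 𝓝[≠] ((t₀ : ℝ) : ℂ), (∑ i, (deriv F z i) ^ 2) - 1 = 0 := htend.frequently hev.frequently
  have hEq := hGa.eqOn_zero_of_preconnected_of_frequently_eq_zero hUc (hsub t₀ (Ioo_subset_Icc_self ht₀)) hfreq
  intro z hz
  have h := hEq hz
  simp only [Pi.zero_apply] at h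
  exact sub_eq_zero.1 h

/-- **Corollary (the skeleton's stadium).**  The stadium `{z | |Im z| < hs ∧ |Re z − cc| < L + hs}` of the registered line is open and
convex, and contains the real segment `[cc − L, cc + L]`; so for a stadium-analytic extension `F` of a unit-speed curve (agreement at
all real points of the stadium) `Σᵢ (F′(z))ᵢ² = 1` on the whole stadium, provided `0 < hs` and `0 < L`. [folklore] -/
theorem sum_sq_deriv_eq_one_on_stadium {hs L cc : ℝ} (hhs : 0 < hs) (hL : 0 < L)
    {F : ℂ → (Fin 3 → ℂ)} (hF : DifferentiableOn ℂ F {z : ℂ | |z.im| < hs ∧ |z.re - cc| < L + hs})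
    {X : ℝ → EuclideanSpace ℝ (Fin 3)}
    (hFX : ∀ t : ℝ, (t : ℂ) ∈ {z : ℂ | |z.im| < hs ∧ |z.re - cc| < L + hs} →
      F t = fun i => ((⟪X t, EuclideanSpace.single i (1:ℝ)⟫_ℝ : ℝ) : ℂ))
    (hX : Differentiable ℝ X) (hunit : ∀ t, ‖deriv X t‖ = 1) :
    ∀ z ∈ {z : ℂ | |z.im| < hs ∧ |z.re - cc| < L + hs}, ∑ i, (deriv F z i) ^ 2 = 1 := by
  set U : Set ℂ := {z : ℂ | |z.im| < hs ∧ |z.re - cc| < L + hs} with hUdef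
  -- `U` is open
  have hUo : IsOpen U := by
    have h1 : IsOpen {z : ℂ | |z.im| < hs} := isOpen_lt (continuous_abs.comp Complex.continuous_im) continuous_const
    have h2 : IsOpen {z : ℂ | |z.re - cc| < L + hs} :=
      isOpen_lt (continuous_abs.comp (Complex.continuous_re.sub continuous_const)) continuous_const
    exact h1.inter h2
  -- `U` is convex, hence preconnected
  have hUconv : Convex ℝ U := by
    have h1 : Convex ℝ {z : ℂ | |z.im| < hs} := by
      have : {z : ℂ | |z.im| < hs} = Complex.imLm ⁻¹' Set.Ioo (-hs) hs := by
        ext z; simp [abs_lt]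
      rw [this]; exact (convex_Ioo _ _).linear_preimage _
    have h2 : Convex ℝ {z : ℂ | |z.re - cc| < L + hs} := by
      have : {z : ℂ | |z.re - cc| < L + hs} = Complex.reLm ⁻¹' Set.Ioo (cc - (L + hs)) (cc + (L + hs)) := by
        ext z; simp only [Set.mem_setOf_eq, Set.mem_preimage, Set.mem_Ioo, Complex.reLm_coe, abs_lt]
        constructor <;> rintro ⟨h₁, h₂⟩ <;> constructor <;> linarith
      rw [this]; exact (convex_Ioo _ _).linear_preimage _
    exact h1.inter h2
  have hUc : IsPreconnected U := hUconv.isPreconnected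
  -- the real segment `[cc - L, cc + L]` lies in `U`
  have hsub : ∀ t : ℝ, t ∈ Set.Icc (cc - L) (cc + L) → (t : ℂ) ∈ U := by
    intro t ht
    refine ⟨by simpa using hhs, ?_⟩
    show |(t : ℂ).re - cc| < L + hs
    rw [Complex.ofReal_re, abs_lt]
    constructor <;> linarith [ht.1, ht.2]
  have hab : cc - L < cc + L := by linarith
  exact sum_sq_deriv_eq_one_of_unit_speed hUo hUc hF hab hsub (fun t ht => hFX t (hsub t ht))
    (fun t _ => hX t) (fun t _ => hunit t)

end Summit.NavierStokesRegularity.NavierStokesRegularity.Theorems.StadiumBilinearUnitSpeed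

end
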